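import Summits.QuantumAdvantage.QuantumAdvantage.Theses.LinnikCubicClassGroups
import Literature.Computability.Cryptography.CubicClassSamplingSpecs
import Literature.Computability.Cryptography.CubicClassStageParams

/-!
# Crux `LinnikCubicClassGroups.PureCubicClassGroupFBQP` (stmt-QuantumAdvantage-11544) — the success probability of the class-group stage

Line `arakelov-giant-step-cycle`, stub `stub_classStageAssembly` (S5b-ASM), helper `classStage_prob`: the ANALYTIC half of the
assembly, free of programs and circuits. For one admissible input (length `n`, data `a, b, m, ps`, `ps ≠ []`) whose class
table `Fv` (read through an injective code) has the structure `ShiftCellCosetTable` at the explicit parameters of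
`CubicClassStageParams` (`T = 3|ps|`, digits `ℓe`, grid `s = ℓy`, coins `ℓκ`, cell count `2^5 (27a²b²)^6`, densities
`2^-(40+2e₆)`, `2^-(30+2e₆)`) with hidden lattice `Λ` of index `≤ hB = (27m²)^10`, the character law
`w(c) = corrMass_Q(c)/Q²` of ONE Fourier-sampling unit (`Q = 2^Lq`, `Lq = top + 0 + s + ℓe·T`) makes `800 (Z+4)²` independent
pairs of units post-process (`postOutC` at `postP`) to `[ℤ^T : Λ]` with probability `≥ 1 − 1/32`: the sampling law (P6,
`ClaimSamplingLaw`) at window `u`, precision `e₆`, slice `K₀`, then the post-processing (P7, `ClaimPost`), the hypotheses and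
the two budget terms being conjuncts of the parameter inequalities (`classStage_params`, taken here as a hypothesis `hpar`).

* `shiftCell_map` — `ShiftCellCosetTable` is transported along an injective re-coding of the values;
* `classStage_prob` — the bound.
-/

-- the problem namespace repeats the summit name (`QuantumAdvantage.QuantumAdvantage`)
set_option linter.dupNamespace false

namespace Summit.QuantumAdvantage.QuantumAdvantage.Theorems.LinnikCubicClassGroups

open Finset
open Literature.Computability.Cryptography.PeriodFinding (corrMass corrMass_nonneg sum_corrMass)
open Literature.Computability.Cryptography.CubicClassSampling (ClaimSamplingLaw ClaimPost ShiftCellCosetTable UnitSamplingLaw)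
open Literature.Computability.Cryptography.CubicClassStageParams
open Literature.Computability.Cryptography.CubicClassPost (PostParams)

/-- **`ShiftCellCosetTable` is transported along an injective re-coding of the values.** -/
theorem shiftCell_map {T ℓe s ℓy ℓκ Ncell : ℕ} {Ω Ω' : Type*} [DecidableEq Ω] [DecidableEq Ω'] (g : Ω → Ω')
    (hg : Function.Injective g) {F : ℕ → Ω} {Λ : AddSubgroup (Fin T → ℤ)} {F₀ : ℕ → Ω} {cls σ : ℕ → ℕ}
    {C : ℕ → ℕ → Ω} {y : ℕ → ℝ} {μ : Fin T → ℝ} {Badκ D : Finset ℕ} {εκ εD : ℝ}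
    (h : ShiftCellCosetTable T ℓe s ℓy ℓκ Ncell F Λ F₀ cls σ C y μ Badκ D εκ εD) :
    ShiftCellCosetTable T ℓe s ℓy ℓκ Ncell (g ∘ F) Λ (g ∘ F₀) cls σ (fun k i => g (C k i)) y μ Badκ D εκ εD := by
  obtain ⟨h1, h2, h3, h4, h5, h6, h7, h8, h9⟩ := h
  refine ⟨h1, fun v hv => ?_, h3, fun E hE j hj hD => ?_, h5, fun E hE E' hE' i hi i' hi' hC => ?_, h7, h8,
    fun E hE => ?_⟩
  · simp only [Function.comp_apply, h2 v hv]
  · simp only [Function.comp_apply, h4 E hE j hj hD]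
  · exact h6 E hE E' hE' i hi i' hi' (hg hC)
  · obtain ⟨hrun, hcount⟩ := h9 E hE
    have himg : (range (2 ^ s)).image (fun i => g (C (cls E) i)) = ((range (2 ^ s)).image (C (cls E))).image g := by
      rw [image_image]; rfl
    refine ⟨fun ω hω => ?_, ?_⟩
    · rw [himg, mem_image] at hω
      obtain ⟨ω₀, hω₀, rfl⟩ := hω
      obtain ⟨b₁, b₂, b₁', b₂', hdisj, hfib⟩ := hrun ω₀ hω₀
      refine ⟨b₁, b₂, b₁', b₂', hdisj, ?_⟩
      rw [← hfib]
      exact filter_congr fun i _ => hg.eq_iff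
    · rw [himg, card_image_of_injective _ hg]
      exact hcount

/-- The error budget on plain variables (instantiated, never normalised, on the huge parameter terms). -/
theorem budget_arith {S E G : ℝ} (hE : E ≤ 1 / 64) (hG : G ≤ 1 / 64) (h : 1 - (E + G) ≤ S) : 1 - (1 : ℝ) / 32 ≤ S := by
  linarith

/-- **S5b-ASM `classStage_prob`** (the analytic half of the assembly): with the sampling law (P6) and the
post-processing (P7), the explicit parameters and their inequalities (`hpar` = the conclusion of `classStage_params`),
a class table with the structural interface at these parameters makes `800 (Z+4)²` pairs of units post-process to the
hidden index with probability `≥ 1 − 1/32`. -/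
theorem classStage_prob :
    ClaimSamplingLaw → ClaimPost → ∀ (Ω : Type) [DecidableEq Ω]
    (code : Ω → List Bool), Function.Injective code → ∀ (n a b mx : ℕ) (ps : List ℕ), ps ≠ [] →
    (20 ≤ leOf n a b ps ∧
      lkOf n a b ps ≤ topOf n a b ps ∧
      topOf n a b ps + sOf n a b + leOf n a b ps * Tp ps = (Z n + 1) ^ 2 ∧
      6 * LD a b + 50 + 2 * e6 n ≤ sOf n a b ∧
      (243 * a ^ 2 * b ^ 2) ^ 2 ≤ capOf a b ps ∧ (∀ p ∈ ps, (243 * a ^ 2 * b ^ 2 * (p + 1)) ^ 2 ≤ capOf a b ps) ∧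
      1 ≤ hB mx ∧ hB mx < 2 ^ (LB n - 2) ∧
      ((1 : ℝ) / 2) ^ (40 + 2 * e6 n) + ((1 : ℝ) / 2) ^ (30 + 2 * e6 n) ≤ ((1 : ℝ) / 2) ^ (2 * e6 n + 8) ∧
      hB mx ^ 3 * (2 * uOf n mx ps) ^ Tp ps * 2 ^ (sOf n a b + e6 n + 40) ≤ 2 ^ leOf n a b ps ∧
      2 ^ 5 * (27 * a ^ 2 * b ^ 2) ^ 6 * hB mx * 2 ^ (2 * e6 n + 16) ≤ 2 ^ sOf n a b ∧
      K0Of n a b mx * (2 ^ (e6 n + 8) * hB mx) ≤ 2 ^ sOf n a b ∧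
      2 ^ sOf n a b ≤ 2 * K0Of n a b mx * (2 ^ (e6 n + 8) * hB mx) ∧
      (4 * (K0Of n a b mx : ℝ) + 2) * ((2 * uOf n mx ps : ℝ) / 2 ^ leOf n a b ps) * (hB mx : ℝ) ^ 2 < 1 ∧
      2 * (800 * ((Z n : ℝ) + 4) ^ 2) * (((1 : ℝ) / 2) ^ e6 n + ((1 : ℝ) / 2) ^ e6 n) ≤ 1 / 64 ∧
      ((hB mx : ℝ) + 1) ^ (Nat.log 2 (hB mx) + 2) *
          ((1 + (1 : ℝ) / 8) ^ 2 / 2 + 3 * (((1 : ℝ) / 2) ^ e6 n + ((1 : ℝ) / 2) ^ e6 n)) ^ (800 * (Z n + 4) ^ 2) ≤ 1 / 64 ∧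
      (1600 * ((Z n : ℝ) + 4) ^ 2) * (1 / (2 ^ 19 * ((Z n : ℝ) + 4) ^ 2)) ≤ 1 / 64) →
    ∀ (Fv : ℕ → Ω) (Λ : AddSubgroup (Fin (Tp ps) → ℤ)) [Λ.FiniteIndex], Λ.index ≤ hB mx →
    ∀ (F₀ : ℕ → Ω) (cls σ : ℕ → ℕ) (C : ℕ → ℕ → Ω) (y : ℕ → ℝ) (μ : Fin (Tp ps) → ℝ) (Badκ D : Finset ℕ),
    ShiftCellCosetTable (Tp ps) (leOf n a b ps) (sOf n a b) (sOf n a b) (lkOf n a b ps)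
      (2 ^ 5 * (27 * a ^ 2 * b ^ 2) ^ 6) Fv Λ F₀ cls σ C y μ Badκ D
      (((1 : ℝ) / 2) ^ (40 + 2 * e6 n)) (((1 : ℝ) / 2) ^ (30 + 2 * e6 n)) →
    1 - (1 : ℝ) / 32 ≤
      ∑ cs : Fin (2 * (800 * (Z n + 4) ^ 2)) → Fin (2 ^ (postP n a b mx ps).Lq),
        if (postP n a b mx ps).postOutC (List.ofFn fun u => ((cs u : ℕ))) = Λ.index then
          ∏ u, corrMass (2 ^ (postP n a b mx ps).Lq) (code ∘ Fv) ((cs u : ℕ) : ℤ) /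
            ((2 : ℝ) ^ (postP n a b mx ps).Lq) ^ 2
        else 0 := by
  intro hLaw hPost Ω _ code hcode n a b mx ps hps hpar Fv Λ _ hΛB F₀ cls σ C y μ Badκ D hSC
  classical
  obtain ⟨_, _, hlayout, _, _, _, h1B, _, heps, hle, hs, hK0a, hK0b, hround, hbud1, hbud2, _⟩ := hpar
  -- ### the sampling law (P6) for the re-coded table
  have hSC' := shiftCell_map code hcode hSC
  have hT : 1 ≤ Tp ps := by
    unfold Tp
    have : 0 < ps.length := List.length_pos_of_ne_nil hps
    omega
  obtain ⟨μ', w₁, hTV, hUSL⟩ := hLaw (Tp ps) (leOf n a b ps) (sOf n a b) (sOf n a b) (lkOf n a b ps) (topOf n a b ps)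
    (2 ^ 5 * (27 * a ^ 2 * b ^ 2) ^ 6) (hB mx) (uOf n mx ps) (e6 n) (K0Of n a b mx) (List Bool) (code ∘ Fv) Λ
    (code ∘ F₀) cls σ (fun k i => code (C k i)) y μ Badκ D _ _ hSC' hT le_rfl
    (by unfold topOf; omega) hΛB h1B (by positivity) (by positivity) heps le_rfl hle hs
    hK0a hK0b
  -- the post-processor parameters: the literal of the sampling law, equal to `postP`
  set P : PostParams := ⟨Tp ps, leOf n a b ps, sOf n a b, sOf n a b - sOf n a b, topOf n a b ps, K0Of n a b mx, hB mx⟩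
    with hPdef
  have hP : P = postP n a b mx ps := by
    rw [hPdef, Nat.sub_self]; rfl
  have hLq : topOf n a b ps + (sOf n a b - sOf n a b) + sOf n a b + leOf n a b ps * Tp ps = P.Lq := rfl
  rw [hLq] at hTV
  -- ### the post-processing (P7)
  set w : ℕ → ℝ := fun c => corrMass (2 ^ P.Lq) (code ∘ Fv) c / ((2 : ℝ) ^ P.Lq) ^ 2 with hw
  have hw0 : ∀ c, 0 ≤ w c := fun c => div_nonneg (corrMass_nonneg _ _ _) (by positivity)
  have hw1 : ∑ c ∈ range (2 ^ P.Lq), w c = 1 := by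
    rw [hw]
    simp only
    rw [← sum_div, sum_corrMass _ (Nat.two_pow_pos _), Nat.cast_pow, Nat.cast_ofNat, div_self (by positivity)]
  have hPT : 1 ≤ P.T := hT
  have hPB : Λ.index ≤ P.B := hΛB
  have hδ : 0 ≤ (2 * uOf n mx ps : ℝ) / 2 ^ leOf n a b ps :=
    div_nonneg (mul_nonneg zero_le_two (Nat.cast_nonneg _)) (pow_nonneg zero_le_two _)
  have hmain := hPost P Λ μ' ((2 * uOf n mx ps : ℝ) / 2 ^ leOf n a b ps) (((1 : ℝ) / 2) ^ e6 n) (1 / 8)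
    (((1 : ℝ) / 2) ^ e6 n) w w₁ (800 * (Z n + 4) ^ 2) hPT hPB hround hδ (by positivity) (by norm_num) (by positivity)
    hw0 hw1 hTV hUSL
  -- ### the budget
  have hbud1' : 2 * ((800 * (Z n + 4) ^ 2 : ℕ) : ℝ) * (((1 : ℝ) / 2) ^ e6 n + ((1 : ℝ) / 2) ^ e6 n) ≤ 1 / 64 := by
    push_cast; exact hbud1
  have hbud2' : ((P.B : ℝ) + 1) ^ (Nat.log 2 P.B + 2) *
      ((1 + (1 : ℝ) / 8) ^ 2 / 2 + 3 * (((1 : ℝ) / 2) ^ e6 n + ((1 : ℝ) / 2) ^ e6 n)) ^ (800 * (Z n + 4) ^ 2) ≤ 1 / 64 :=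
    hbud2
  have hfin : 1 - (1 : ℝ) / 32 ≤ ∑ cs : Fin (2 * (800 * (Z n + 4) ^ 2)) → Fin (2 ^ P.Lq),
      if P.postOutC (List.ofFn fun u => ((cs u : ℕ))) = Λ.index then ∏ u, w (cs u) else 0 :=
    budget_arith hbud1' hbud2' hmain
  rw [hw, hP] at hfin
  exact hfin

end Summit.QuantumAdvantage.QuantumAdvantage.Theorems.LinnikCubicClassGroups
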